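import Summits.BirchSwinnertonDyer.Rank1Residual.X11b.InterpolationCharacterSupply
import Summits.BirchSwinnertonDyer.Rank1Residual.X11b.BDPValueRigidity
import Summits.BirchSwinnertonDyer.Rank1Residual.X11b.BDPFrameUniqueness
import Summits.BirchSwinnertonDyer.Rank1Residual.X11b.HsiehFrameUniqueness
import HarnessLib

/-!
# Class X11b, every odd prime `p`: the interpolation-character SUPPLY in the consumers' shapes, and
# the RIGIDITY THEOREMS WITHOUT SUPPLY HYPOTHESES — frame uniqueness over `R₀⟦T⟧` and `𝓞_{ℂ_p}⟦T⟧`,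
# Hsieh-witness uniqueness, and x11b3's V1RIG (value at `𝟙` across periods) at every anticyclotomic
# datum (cell `b2b-bsdres`, sub-cell `multr1-p2`, gen 25)

HONEST FRAMING (cell `b2b-bsdres`, run/shared/lean/b2b/bsd-rank1-residual/, verbatim in every
file): the goal of the cell is to DELETE the COMBINATION-SHAPED residual classes of the
Birch–Swinnerton-Dyer formula for ALL analytic-rank `≤ 1` elliptic curves over `ℚ` — "full BSD
formula for every rank `≤ 1` curve in class `C`" assembled STRICTLY from published theorems — so
that the rank-`≤ 1` remainder becomes exactly the CONSTRUCTION-SHAPED classes, which are TYPED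
(missing-input `Prop`s), NOT attempted. This is not "finishing BSD". Sub-cell `multr1-p2` is a
RESEARCH ROUTE on class X11b (`ClassX11b W p := r_an = 1 ∧ p ≠ 2 ∧ mult(p) ∧ irr(p)`); no claim
beyond the stated class and loci; X11b's label does not change; NOTHING is booked by this file.

THEOREMS ONLY (no definition, no named fact, no `sorry`). CREDIT: the rigidity theorems themselves
are multr1-p1's (`isBDPLFunction_unique_of_tendsto`, GEN 23 `X11b/BDPFrameUniqueness.lean`;
`R1.isBDPLFunctionInt_unique_of_tendsto`, `X11b/BDPFrameUniquenessInt.lean`), x11b3-p3's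
(`constantCoeff_eq_of_isBDPLFunction_of_supply`, S27 'V1RIG', `X11b/BDPValueRigidity.lean`) and this
sub-cell's gen 24 (`isHsiehLFunction_unique_of_tendsto`); this file only DISCHARGES their supply
hypotheses with gen 25's `LambdaSupply.exists_interpolationCharacter` — nothing of theirs is restated.

## What this file proves (odd `p`; `K` imaginary quadratic; `κ : Γ_K ↠ ℤ_p` ANTICYCLOTOMIC with
## topological generator `γ`; `ι : ℚ̄_p ≃ ℂ`)

* §1 **`exists_interpolationSupply`** — the sequence shape: `(φ_k, n_k, r_k)_k` with `n_k > 0`, `φ_k`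
  unramified everywhere of infinity type `(n_k, −n_k)`, `IsPAdicAvatarOf ι φ_k r_k`,
  `FactorsThroughZp κ r_k`, `r_k(γ) → 1`, `r_k(γ) ≠ 1` (the binders of multr1-p1's / gen 24's
  rigidity theorems); **`exists_interpolationSupply_pow`** — x11b3-p3's V1RIG binder shape (`m > 0`,
  `x₀` with `x₀^{p^k} ≠ 1`, `x₀^{p^k} → 1`, the families `φ^{p^k}` / `φ^{2p^k}` of types `m p^k` /
  `2 m p^k` with avatar values `x₀^{p^k}` / `x₀^{2 p^k}`).
* §2 RIGIDITY WITHOUT SUPPLY HYPOTHESES at every such `(p, K, κ, γ, ι)`: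
  **`isBDPLFunction_unique_of_isAnticyclotomic`** (two `L, L' ∈ R₀⟦T⟧` with the same
  `IsBDPLFunction ι 𝔭 κ γ f Ω_K Ω_p` are EQUAL), **`isBDPLFunctionInt_unique_of_isAnticyclotomic`**
  (the same over `𝓞_{ℂ_p}⟦T⟧`), **`isHsiehLFunction_unique_of_isAnticyclotomic`** (Hsieh witnesses at
  fixed data), **`constantCoeff_eq_of_isBDPLFunction_of_isAnticyclotomic`** (V1RIG: two `R₀`-frames of
  the same `(ι, 𝔭, κ, γ, f)` with ANY nonzero periods have the same value at `𝟙`).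

Consequences for the cell's bookkeeping (no mark moved by this file): multr1-p1's descent chain
(STEP A rigidity + STEP B twist intersection) loses its "supply of characters" proviso at every odd
`p`; x11b3's S27 readings at `p = 3` may drop their supply binders (`p = 3` is odd); gen 24's
Hsieh-witness rigidity is unconditional at p2's data.

## References

* [Castella2018] F. Castella, Math. Ann. 370 (2018), Thm. 3.1 (arXiv:1704.06608 p. 9).
* [CastellaHsieh2018] §3.3, Def. 3.5, Prop. 3.6. * [Hsieh2014] Thm. 1. * [Greenberg1987] §2.
-/

noncomputable section

open scoped NumberField
open NumberField IsDedekindDomain Field Filter Topology PowerSeries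
  Literature.NumberTheory.GaloisRepresentations Literature.NumberTheory.EllipticCurves
  Literature.NumberTheory.Automorphic

namespace Summit.BirchSwinnertonDyer.Rank1Residual.X11b

open Summit.BirchSwinnertonDyer.Rank1Residual.X11b.LambdaSupply
open Summit.BirchSwinnertonDyer.Rank1Residual.X11b.Three.LambdaSupply
open Summit.BirchSwinnertonDyer.Rank1Residual.X11b.Halves

variable {p : ℕ} [Fact p.Prime]

/-! ### §1 The supply in the consumers' shapes -/

section Shapes

/-- **THE INTERPOLATION-CHARACTER SUPPLY, sequence shape** (odd `p`; `K` imaginary quadratic; `κ`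
anticyclotomic with topological generator `γ`; `ι`): a family `(φ_k, n_k, r_k)` — `φ_k = φ^{p^k}`,
`n_k = m p^k`, `r_k = e ∘ ψ^{p^k}` for the interpolation character `(φ, m, ψ)` of
`LambdaSupply.exists_interpolationCharacter` — with `n_k > 0`, `φ_k` unramified everywhere of infinity
type `(n_k, −n_k)`, `IsPAdicAvatarOf ι φ_k r_k`, `FactorsThroughZp κ r_k`, `r_k(γ) = x₀^{p^k} → 1`
(`x₀` a principal unit) and `r_k(γ) ≠ 1` for every `k`. These are VERBATIM the binders `hn hunr hinf hr
hκ hlim` (+ `hne`) of multr1-p1's `isBDPLFunction_unique_of_tendsto` /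
`R1.isBDPLFunctionInt_unique_of_tendsto` and of gen 24's `isHsiehLFunction_unique_of_tendsto`.
[cite: Castella2018, Thm. 3.1 (arXiv:1704.06608 p. 9)] [cite: Greenberg1987, §2] -/
theorem exists_interpolationSupply (hp2 : p ≠ 2) (ι : PadicAlgCl p ≃+* ℂ) (K : Type) [Field K]
    [NumberField K] (κ : ZpExtension K p) (hK : IsImaginaryQuadratic K) (hκ : κ.IsAnticyclotomic)
    (γ : absoluteGaloisGroup K) (hγ : κ.IsTopGenerator γ) :
    ∃ (φ : ℕ → HeckeCharacter K) (n : ℕ → ℕ) (r : ℕ → FramedGaloisRep K (PadicAlgCl p) 1),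
      (∀ k, 0 < n k) ∧ (∀ k (v : HeightOneSpectrum (𝓞 K)), (φ k).IsUnramifiedAt v) ∧
      (∀ k, (φ k).HasInfinityType (fun _ ↦ (n k : ℤ)) (fun _ ↦ -(n k : ℤ))) ∧
      (∀ k, IsPAdicAvatarOf ι (φ k) (r k)) ∧ (∀ k, FactorsThroughZp κ (r k)) ∧
      Tendsto (fun k ↦ avatarValueAt (r k) γ) atTop (𝓝 1) ∧
      (∀ k, avatarValueAt (r k) γ ≠ 1) := by
  have hp : p.Prime := Fact.out
  obtain ⟨φ, m, ψ, hm, hunr, hinf, hav, hfac, hx1, hx⟩ :=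
    exists_interpolationCharacter hp2 ι K κ hK hκ γ hγ
  set x₀ := avatarValueAt ((FramedRep.unitsContinuousMulEquivOfUnique (Fin 1) (PadicAlgCl p) :
    (PadicAlgCl p)ˣ →ₜ* GL (Fin 1) (PadicAlgCl p)).comp ψ) γ with hx₀
  refine ⟨fun k => φ ^ p ^ k, fun k => m * p ^ k,
    fun k => (FramedRep.unitsContinuousMulEquivOfUnique (Fin 1) (PadicAlgCl p) :
      (PadicAlgCl p)ˣ →ₜ* GL (Fin 1) (PadicAlgCl p)).comp (ψ ^ p ^ k),
    fun k => Nat.mul_pos hm (pow_pos hp.pos k), fun k v => isUnramifiedAt_pow' (hunr v) _,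
    fun k => ?_, fun k => isPAdicAvatarOf_pow ι hav (fun v _ => hunr v) _,
    fun k => factorsThroughZp_unitsChar_pow κ hfac _, ?_, fun k => ?_⟩
  · have h := HasInfinityType.pow_nat hinf (p ^ k)
    convert h using 2 <;> push_cast <;> ring
  · have hval : (fun k : ℕ => avatarValueAt ((FramedRep.unitsContinuousMulEquivOfUnique (Fin 1)
        (PadicAlgCl p) : (PadicAlgCl p)ˣ →ₜ* GL (Fin 1) (PadicAlgCl p)).comp (ψ ^ p ^ k)) γ) =
        fun k => x₀ ^ p ^ k := funext fun k => avatarValueAt_unitsChar_pow ψ γ _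
    rw [hval]
    exact PadicUnits.tendsto_pow_prime_pow_nhds_one (p := p) (by rwa [norm_sub_rev] at hx1)
  · rw [avatarValueAt_unitsChar_pow]
    exact hx k

/-- **The supply in x11b3-p3's V1RIG shape** (binders `hm _hx1 hx hunr hinf hr hrκ hval hunr' hinf' hr'
hrκ' hval'` of `constantCoeff_eq_of_isBDPLFunction_of_supply` VERBATIM): `m > 0`, `x₀ ∈ ℂ_p` with
`x₀^{p^k} ≠ 1` and `x₀^{p^k} → 1`, and the two families `φ^{p^k}` (type `m p^k`, avatar value
`x₀^{p^k}`) and `φ^{2 p^k}` (type `2 m p^k`, avatar value `x₀^{2 p^k}`).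
[cite: Castella2018, Thm. 3.1 (arXiv:1704.06608 p. 9)] [cite: Greenberg1987, §2] -/
theorem exists_interpolationSupply_pow (hp2 : p ≠ 2) (ι : PadicAlgCl p ≃+* ℂ) (K : Type) [Field K]
    [NumberField K] (κ : ZpExtension K p) (hK : IsImaginaryQuadratic K) (hκ : κ.IsAnticyclotomic)
    (γ : absoluteGaloisGroup K) (hγ : κ.IsTopGenerator γ) :
    ∃ (m : ℕ) (x₀ : ℂ_[p]) (φ φ' : ℕ → HeckeCharacter K)
      (r r' : ℕ → FramedGaloisRep K (PadicAlgCl p) 1),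
      0 < m ∧ (∀ k, x₀ ^ p ^ k ≠ 1) ∧ Tendsto (fun k ↦ x₀ ^ p ^ k) atTop (𝓝 1) ∧
      (∀ k (v : HeightOneSpectrum (𝓞 K)), (φ k).IsUnramifiedAt v) ∧
      (∀ k, (φ k).HasInfinityType (fun _ ↦ ((m * p ^ k : ℕ) : ℤ)) (fun _ ↦ -((m * p ^ k : ℕ) : ℤ))) ∧
      (∀ k, IsPAdicAvatarOf ι (φ k) (r k)) ∧ (∀ k, FactorsThroughZp κ (r k)) ∧
      (∀ k, avatarValueAt (r k) γ = x₀ ^ p ^ k) ∧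
      (∀ k (v : HeightOneSpectrum (𝓞 K)), (φ' k).IsUnramifiedAt v) ∧
      (∀ k, (φ' k).HasInfinityType (fun _ ↦ ((2 * m * p ^ k : ℕ) : ℤ))
        (fun _ ↦ -((2 * m * p ^ k : ℕ) : ℤ))) ∧
      (∀ k, IsPAdicAvatarOf ι (φ' k) (r' k)) ∧ (∀ k, FactorsThroughZp κ (r' k)) ∧
      (∀ k, avatarValueAt (r' k) γ = x₀ ^ (2 * p ^ k)) := by
  obtain ⟨φ, m, ψ, hm, hunr, hinf, hav, hfac, hx1, hx⟩ :=
    exists_interpolationCharacter hp2 ι K κ hK hκ γ hγ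
  refine ⟨m, avatarValueAt ((FramedRep.unitsContinuousMulEquivOfUnique (Fin 1) (PadicAlgCl p) :
      (PadicAlgCl p)ˣ →ₜ* GL (Fin 1) (PadicAlgCl p)).comp ψ) γ,
    fun k => φ ^ p ^ k, fun k => φ ^ (2 * p ^ k),
    fun k => (FramedRep.unitsContinuousMulEquivOfUnique (Fin 1) (PadicAlgCl p) :
      (PadicAlgCl p)ˣ →ₜ* GL (Fin 1) (PadicAlgCl p)).comp (ψ ^ p ^ k),
    fun k => (FramedRep.unitsContinuousMulEquivOfUnique (Fin 1) (PadicAlgCl p) :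
      (PadicAlgCl p)ˣ →ₜ* GL (Fin 1) (PadicAlgCl p)).comp (ψ ^ (2 * p ^ k)),
    hm, hx, PadicUnits.tendsto_pow_prime_pow_nhds_one (p := p) (by rwa [norm_sub_rev] at hx1),
    fun k v => isUnramifiedAt_pow' (hunr v) _, fun k => ?_,
    fun k => isPAdicAvatarOf_pow ι hav (fun v _ => hunr v) _,
    fun k => factorsThroughZp_unitsChar_pow κ hfac _, fun k => avatarValueAt_unitsChar_pow ψ γ _,
    fun k v => isUnramifiedAt_pow' (hunr v) _, fun k => ?_,
    fun k => isPAdicAvatarOf_pow ι hav (fun v _ => hunr v) _,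
    fun k => factorsThroughZp_unitsChar_pow κ hfac _, fun k => avatarValueAt_unitsChar_pow ψ γ _⟩
  · have h := HasInfinityType.pow_nat hinf (p ^ k)
    convert h using 2 <;> push_cast <;> ring
  · have h := HasInfinityType.pow_nat hinf (2 * p ^ k)
    convert h using 2 <;> push_cast <;> ring

end Shapes

/-! ### §2 Rigidity without supply hypotheses -/

section Rigidity

variable {K : Type} [Field K] [NumberField K] {N : ℕ}

/-- **Frame rigidity over `R₀⟦T⟧`, UNCONDITIONAL at anticyclotomic data** (multr1-p1's
`isBDPLFunction_unique_of_tendsto` with the supply of `exists_interpolationSupply`): for odd `p`, `K`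
imaginary quadratic, `κ` anticyclotomic with topological generator `γ`, two `L, L' ∈ R₀⟦T⟧` with
`IsBDPLFunction ι 𝔭 κ γ f Ω_K Ω_p L` and `… L'` (the SAME data) are EQUAL — Castella's Thm. 3.1
display characterises ONE element. [cite: Castella2018, Thm. 3.1 (arXiv:1704.06608 p. 9)]
[cite: CastellaHsieh2018, §3.3, Def. 3.5 and Prop. 3.6] -/
theorem isBDPLFunction_unique_of_isAnticyclotomic (hp2 : p ≠ 2) {ι : PadicAlgCl p ≃+* ℂ}
    {𝔭 : HeightOneSpectrum (𝓞 K)} {κ : ZpExtension K p} {γ : absoluteGaloisGroup K}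
    {f : CuspForm (CongruenceSubgroup.Gamma0 N) 2} {ΩK : ℂ} {Ωp : ℂ_[p]}
    (hK : IsImaginaryQuadratic K) (hκ : κ.IsAnticyclotomic) (hγ : κ.IsTopGenerator γ)
    {L L' : UnrSeries p} (hL : IsBDPLFunction ι 𝔭 κ γ f ΩK Ωp L)
    (hL' : IsBDPLFunction ι 𝔭 κ γ f ΩK Ωp L') : L = L' := by
  obtain ⟨φ, n, r, hn, hunr, hinf, hr, hrκ, hlim, hne⟩ :=
    exists_interpolationSupply hp2 ι K κ hK hκ γ hγ
  exact isBDPLFunction_unique_of_tendsto hL hL' hn hunr hinf hr hrκ hlim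
    (Frequently.of_forall hne)

/-- **Frame rigidity over `𝓞_{ℂ_p}⟦T⟧`, UNCONDITIONAL at anticyclotomic data** (multr1-p1's STEP A
`R1.isBDPLFunctionInt_unique_of_tendsto` with the supply of `exists_interpolationSupply`): two
`Q, Q' ∈ 𝓞_{ℂ_p}⟦T⟧` with `R1.IsBDPLFunctionInt p ι 𝔭 κ γ f Ω_K Ω_p ·` are EQUAL. So the "supply of
characters" proviso of multr1-p1's `R₀`-descent chain (GEN 23–24) is DISCHARGED at every odd `p`.
[cite: Castella2018, Thm. 3.1 and p. 9 ll. 42–47 (arXiv:1704.06608)] -/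
theorem isBDPLFunctionInt_unique_of_isAnticyclotomic (hp2 : p ≠ 2) {ι : PadicAlgCl p ≃+* ℂ}
    {𝔭 : HeightOneSpectrum (𝓞 K)} {κ : ZpExtension K p} {γ : absoluteGaloisGroup K}
    {f : CuspForm (CongruenceSubgroup.Gamma0 N) 2} {ΩK : ℂ} {Ωp : ℂ_[p]}
    (hK : IsImaginaryQuadratic K) (hκ : κ.IsAnticyclotomic) (hγ : κ.IsTopGenerator γ)
    {Q Q' : PowerSeries 𝓞_ℂ_[p]} (hQ : R1.IsBDPLFunctionInt p ι 𝔭 κ γ f ΩK Ωp Q)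
    (hQ' : R1.IsBDPLFunctionInt p ι 𝔭 κ γ f ΩK Ωp Q') : Q = Q' := by
  obtain ⟨φ, n, r, hn, hunr, hinf, hr, hrκ, hlim, hne⟩ :=
    exists_interpolationSupply hp2 ι K κ hK hκ γ hγ
  exact R1.isBDPLFunctionInt_unique_of_tendsto hQ hQ' hn hunr hinf hr hrκ hlim
    (Frequently.of_forall hne)

/-- **Hsieh-witness rigidity at fixed data, UNCONDITIONAL at anticyclotomic data** (gen 24's
`isHsiehLFunction_unique_of_tendsto` with the supply of `exists_interpolationSupply`): two
`Q, Q' ∈ 𝓞_{ℂ_p}⟦T⟧` with `IsHsiehLFunction ι 𝔭 κ γ f A Ω_K C Ω_p ·` (the SAME Hsieh data) are EQUAL.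
[cite: Hsieh2014, Thm. 1 (arXiv:1112.1580 pp. 3–4)] -/
theorem isHsiehLFunction_unique_of_isAnticyclotomic (hp2 : p ≠ 2) {ι : PadicAlgCl p ≃+* ℂ}
    {𝔭 : HeightOneSpectrum (𝓞 K)} {κ : ZpExtension K p} {γ : absoluteGaloisGroup K}
    {f : CuspForm (CongruenceSubgroup.Gamma0 N) 2} {A : ℝ} {ΩK C : ℂ} {Ωp : ℂ_[p]}
    (hK : IsImaginaryQuadratic K) (hκ : κ.IsAnticyclotomic) (hγ : κ.IsTopGenerator γ)
    {Q Q' : PowerSeries 𝓞_ℂ_[p]} (hQ : IsHsiehLFunction ι 𝔭 κ γ f A ΩK C Ωp Q)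
    (hQ' : IsHsiehLFunction ι 𝔭 κ γ f A ΩK C Ωp Q') : Q = Q' := by
  obtain ⟨φ, n, r, hn, hunr, hinf, hr, hrκ, hlim, hne⟩ :=
    exists_interpolationSupply hp2 ι K κ hK hκ γ hγ
  exact isHsiehLFunction_unique_of_tendsto hQ hQ' hn hunr hinf hr hrκ hlim (Frequently.of_forall hne)

/-- **V1RIG WITHOUT SUPPLY HYPOTHESES — the value at `𝟙` does not see the periods** (x11b3-p3's S27
`constantCoeff_eq_of_isBDPLFunction_of_supply` with the supply of `exists_interpolationSupply_pow`): for
odd `p`, `K` imaginary quadratic, `κ` anticyclotomic with topological generator `γ`, two `R₀`-frames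
`IsBDPLFunction ι 𝔭 κ γ f Ω_K Ω_p L`, `IsBDPLFunction ι 𝔭 κ γ f Ω_K' Ω_p' L'` of the SAME
`(ι, 𝔭, κ, γ, f)` with ANY nonzero periods have `[T⁰]L' = [T⁰]L`. CREDIT: x11b3-p3 (p263231 /
p263893 / p264499); this corollary only removes the binders. Nothing booked.
[cite: Castella2018, Thm. 3.1–3.2 (arXiv:1704.06608 pp. 8–9)] [cite: CastellaHsieh2018, §3.3, Def. 3.5 and Prop. 3.6] -/
theorem constantCoeff_eq_of_isBDPLFunction_of_isAnticyclotomic (hp2 : p ≠ 2) (K : Type) [Field K]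
    [NumberField K] (N : ℕ) (ι : PadicAlgCl p ≃+* ℂ) (𝔭 : HeightOneSpectrum (𝓞 K))
    (κ : ZpExtension K p) (γ : absoluteGaloisGroup K) (hK : IsImaginaryQuadratic K)
    (hκ : κ.IsAnticyclotomic) (hγ : κ.IsTopGenerator γ) (f : CuspForm (CongruenceSubgroup.Gamma0 N) 2)
    (ΩK ΩK' : ℂ) (Ωp Ωp' : ℂ_[p]) (L L' : UnrSeries p) (hΩK : ΩK ≠ 0) (hΩK' : ΩK' ≠ 0)
    (hΩp : Ωp ≠ 0) (hΩp' : Ωp' ≠ 0) (hL : IsBDPLFunction ι 𝔭 κ γ f ΩK Ωp L)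
    (hL' : IsBDPLFunction ι 𝔭 κ γ f ΩK' Ωp' L') :
    PowerSeries.constantCoeff L' = PowerSeries.constantCoeff L := by
  obtain ⟨m, x₀, φ, φ', r, r', hm, hx1, hx, hunr, hinf, hr, hrκ, hval, hunr', hinf', hr', hrκ', hval'⟩ :=
    exists_interpolationSupply_pow hp2 ι K κ hK hκ γ hγ
  exact constantCoeff_eq_of_isBDPLFunction_of_supply K N ι 𝔭 κ γ f ΩK ΩK' Ωp Ωp' L L' m x₀ φ φ' r r'
    hm hx1 hx hunr hinf hr hrκ hval hunr' hinf' hr' hrκ' hval' hΩK hΩK' hΩp hΩp' hL hL'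

end Rigidity

end Summit.BirchSwinnertonDyer.Rank1Residual.X11b

end
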